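import Summits.BirchSwinnertonDyer.BirchSwinnertonDyer.Theorems.EisensteinDepletionAtTwoStarKummerDefs
import Summits.BirchSwinnertonDyer.BirchSwinnertonDyer.Theorems.EisensteinDepletionAtTwoStarGO2KEtaEulerClassLaw
import HarnessLib

/-!
# Route `EisensteinDepletionAtTwo`, crux `StarGO2Sigma` (stmt-BirchSwinnertonDyer-27046), line `kummer` v7 —
# KΘp `stub_thetaPatternParity`: the parity of the theta pattern `θ_T = Σ_{t ∈ T(N)} θ′_t` is the LEVEL PATTERN

planner bsd-rank2-p2 GEN 38, PART 15 (evidence for 27046; the lead lands it `--supports 27046`).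

THE CLAIM (KΘp of HOME/p2/g38/KUMMER-V7-DESIGN.md): for odd `N` with all exponents `≤ 2` and every `n`,
`coeff_n θ_T` is odd iff `v₂(n)` is even and `LevelPattern N (n / 2^{v₂ n})`, where `θ_T = Σ_{t ∈ T(N)} θ′_t`,
`θ′_t = Σ_{k≥1} q^{tk²}`, `T(N) = kummerThetaDivisors N`, and `LevelPattern N n :⟺ n ≠ 0 ∧ ∀ p ∣ n prime,
(v_p(N) = 0 ∧ v_p(n) even) ∨ v_p(N) = 1`.

PROOF (finite divisor combinatorics, sorry-free): `coeff_n θ_T = #T_n`, `T_n = {t ∈ T(N) : n = t·k²}`.  If some prime `p ∣ n`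
has (`v_p N = 0`, `v_p n` odd) or (`v_p N = 2`, `v_p n` odd) then `T_n = ∅`; if some `p ∣ n` has `v_p N = 2`, `v_p n` even, then
`t ↦ t·p²` is a bijection `{t ∈ T_n : p ∤ t} → {t ∈ T_n : p ∣ t}`, so `#T_n` is even; otherwise (`LevelPattern N n`) `T_n` is the
single divisor `t₀ = ∏_{p ∥ N, v_p n odd} p`.  No elliptic curve, no analysis.  [cite: Stevens1982, §2.4 (PDF pp. 35–37)] [folklore]
-/

set_option autoImplicit false
set_option linter.dupNamespace false

noncomputable section

namespace Summit.BirchSwinnertonDyer.BirchSwinnertonDyer.Theorems.DepletionAtTwo.KEta.ThetaPattern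

open PowerSeries Finset

/-! ## §0 The objects (verbatim the v7 design's `thetaSq`, `thetaPattern`, `LevelPattern`) -/

open Summit.BirchSwinnertonDyer.BirchSwinnertonDyer.Theorems.DepletionAtTwo.KEta.EulerClassLaw (thetaSq)

/-- The theta pattern `θ_T = Σ_{t ∈ T(N)} θ'_t`. [cite: Stevens1982, §2.4 (PDF pp. 35–37)] -/
def thetaPattern (N : ℕ) : PowerSeries ℤ := ∑ t ∈ kummerThetaDivisors N, thetaSq t

/-- The level pattern: `n ≠ 0` and every prime of `n` is multiplicative for the level (`v_p(N) = 1`) or good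
(`v_p(N) = 0`) with even exponent in `n`. [cite: SilvermanAEC2009, App. C §16] -/
def LevelPattern (N n : ℕ) : Prop :=
  n ≠ 0 ∧ ∀ p ∈ n.primeFactors, (N.factorization p = 0 ∧ Even (n.factorization p)) ∨ N.factorization p = 1

/-! ## §1 Squares via factorizations -/

/-- `m ≠ 0` is a square iff all its exponents are even. [folklore] -/
theorem exists_eq_sq_iff {m : ℕ} (hm : m ≠ 0) : (∃ k : ℕ, m = k ^ 2) ↔ ∀ p : ℕ, Even (m.factorization p) := by
  constructor
  · rintro ⟨k, rfl⟩ p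
    rw [Nat.factorization_pow, Finsupp.smul_apply, smul_eq_mul]
    exact even_two_mul _
  · intro h
    refine ⟨∏ p ∈ m.primeFactors, p ^ (m.factorization p / 2), ?_⟩
    rw [← Finset.prod_pow]
    simp_rw [← pow_mul]
    have key : ∀ p ∈ m.primeFactors, p ^ (m.factorization p / 2 * 2) = p ^ m.factorization p := fun p _ ↦ by
      rw [Nat.div_mul_cancel (even_iff_two_dvd.mp (h p))]
    rw [Finset.prod_congr rfl key]
    have hself := Nat.prod_factorization_pow_eq_self hm
    rw [Finsupp.prod, Nat.support_factorization] at hself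
    exact hself.symm

/-! ## §2 The count `#T_n` -/

open Classical in
/-- `T_n = {t ∈ T(N) : n = t·k² for some k}`. [folklore] -/
def tset (N n : ℕ) : Finset ℕ := (kummerThetaDivisors N).filter fun t ↦ ∃ k : ℕ, n = t * k ^ 2

/-- `coeff_n θ_T = #T_n` for `n ≠ 0`. [folklore] -/
theorem coeff_thetaPattern {N n : ℕ} (hn : n ≠ 0) : coeff n (thetaPattern N) = ((tset N n).card : ℤ) := by
  classical
  rw [thetaPattern, map_sum, tset]
  simp only [thetaSq, coeff_mk, hn, ne_eq, not_false_eq_true, true_and]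
  rw [Finset.sum_boole]

/-- `coeff_0 θ_T = 0`. [folklore] -/
theorem coeff_zero_thetaPattern (N : ℕ) : coeff 0 (thetaPattern N) = 0 := by
  classical
  rw [thetaPattern, map_sum]
  refine Finset.sum_eq_zero fun t _ ↦ ?_
  simp [thetaSq, coeff_mk]

/-- Membership in `T_n` via exponents: `t ∈ T(N)`, `t ∣ n`, and `v_p(n) − v_p(t)` even for all `p`. [folklore] -/
theorem mem_tset {N n t : ℕ} (hn : n ≠ 0) :
    t ∈ tset N n ↔ t ∈ kummerThetaDivisors N ∧ t ∣ n ∧ ∀ p : ℕ, Even (n.factorization p - t.factorization p) := by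
  classical
  rw [tset, Finset.mem_filter]
  refine and_congr_right fun _ ↦ ?_
  constructor
  · rintro ⟨k, hk⟩
    have htd : t ∣ n := ⟨k ^ 2, hk⟩
    have ht0 : t ≠ 0 := by rintro rfl; exact hn (by rw [hk, zero_mul])
    refine ⟨htd, fun p ↦ ?_⟩
    have hq : n / t = k ^ 2 := by rw [hk, Nat.mul_div_cancel_left _ (Nat.pos_of_ne_zero ht0)]
    have hne : n / t ≠ 0 := by rw [hq]; intro h; apply hn; rw [hk, h, mul_zero]
    have := (exists_eq_sq_iff hne).mp ⟨k, hq⟩ p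
    rwa [Nat.factorization_div htd, Finsupp.tsub_apply] at this
  · rintro ⟨htd, hev⟩
    have ht0 : t ≠ 0 := by rintro rfl; exact hn (zero_dvd_iff.mp htd)
    have hne : n / t ≠ 0 := (Nat.div_pos (Nat.le_of_dvd (Nat.pos_of_ne_zero hn) htd) (Nat.pos_of_ne_zero ht0)).ne'
    have hev' : ∀ p, Even ((n / t).factorization p) := fun p ↦ by
      rw [Nat.factorization_div htd, Finsupp.tsub_apply]; exact hev p
    obtain ⟨k, hk⟩ := (exists_eq_sq_iff hne).mpr hev'
    exact ⟨k, by rw [← hk, Nat.mul_div_cancel' htd]⟩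

/-- Membership in `T_n` purely through exponents (for `n, N ≠ 0`). [folklore] -/
theorem mem_tset_iff {N n t : ℕ} (hN : N ≠ 0) (hn : n ≠ 0) :
    t ∈ tset N n ↔ t ≠ 0 ∧ ∀ q : ℕ, t.factorization q ≤ N.factorization q ∧
      (2 ≤ N.factorization q → t.factorization q ≠ 1) ∧ t.factorization q ≤ n.factorization q ∧
      Even (n.factorization q - t.factorization q) := by
  rw [mem_tset hn, mem_kummerThetaDivisors, Nat.mem_divisors]
  constructor
  · rintro ⟨⟨⟨htN, -⟩, hT⟩, htn, hev⟩
    have ht0 : t ≠ 0 := by rintro rfl; exact hN (zero_dvd_iff.mp htN)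
    refine ⟨ht0, fun q ↦ ⟨(Nat.factorization_le_iff_dvd ht0 hN).mpr htN q, fun h2 ↦ ?_,
      (Nat.factorization_le_iff_dvd ht0 hn).mpr htn q, hev q⟩⟩
    have hq : q ∈ N.primeFactors := by
      rw [← Nat.support_factorization, Finsupp.mem_support_iff]; omega
    exact hT q hq h2
  · rintro ⟨ht0, h⟩
    refine ⟨⟨⟨(Nat.factorization_le_iff_dvd ht0 hN).mp fun q ↦ (h q).1, hN⟩, fun ℓ _ h2 ↦ (h ℓ).2.1 h2⟩,
      (Nat.factorization_le_iff_dvd ht0 hn).mp fun q ↦ (h q).2.2.1, fun q ↦ (h q).2.2.2⟩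

/-! ## §3 The three cases -/

/-- A prime of `n` that is good for `N` with odd exponent empties `T_n`. [folklore] -/
theorem tset_eq_empty_of_good {N n p : ℕ} (hN : N ≠ 0) (hn : n ≠ 0) (hNp : N.factorization p = 0)
    (hodd : Odd (n.factorization p)) : tset N n = ∅ := by
  refine Finset.eq_empty_of_forall_notMem fun t ht ↦ ?_
  obtain ⟨-, h⟩ := (mem_tset_iff hN hn).mp ht
  obtain ⟨hle, -, -, hev⟩ := h p
  rw [hNp, Nat.le_zero] at hle
  rw [hle, Nat.sub_zero] at hev
  exact (Nat.not_even_iff_odd.mpr hodd) hev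

/-- A prime with `p² ∥ N` and odd exponent in `n` empties `T_n`. [folklore] -/
theorem tset_eq_empty_of_sq {N n p : ℕ} (hN : N ≠ 0) (hn : n ≠ 0) (hNp : N.factorization p = 2)
    (hodd : Odd (n.factorization p)) : tset N n = ∅ := by
  refine Finset.eq_empty_of_forall_notMem fun t ht ↦ ?_
  obtain ⟨-, h⟩ := (mem_tset_iff hN hn).mp ht
  obtain ⟨hle, hT, hle', hev⟩ := h p
  rw [hNp] at hle
  have hv : Even (t.factorization p) := by
    rcases Nat.even_or_odd (t.factorization p) with h | h
    · exact h
    · exfalso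
      obtain ⟨r, hr⟩ := h
      exact hT (by rw [hNp]) (by omega)
  exact (Nat.not_even_iff_odd.mpr hodd) (((Nat.even_sub hle').mp hev).mpr hv)

/-- Exponents of `t·p²`. [folklore] -/
theorem factorization_mul_sq {t p : ℕ} (ht : t ≠ 0) (hp : p.Prime) (q : ℕ) :
    (t * p ^ 2).factorization q = t.factorization q + if p = q then 2 else 0 := by
  rw [Nat.factorization_mul ht (pow_ne_zero 2 hp.ne_zero), Finsupp.add_apply, hp.factorization_pow, Finsupp.single_apply]

/-- A prime with `p² ∥ N`, `p ∣ n` and even exponent in `n` pairs `T_n` off: `#T_n` is even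
(`t ↦ t·p²` is a bijection from `{p ∤ t}` to `{p ∣ t}`). [folklore] -/
theorem even_card_tset_of_sq {N n p : ℕ} (hN : N ≠ 0) (hn : n ≠ 0) (hp : p ∈ n.primeFactors)
    (hNp : N.factorization p = 2) (hev : Even (n.factorization p)) : Even (tset N n).card := by
  classical
  have hpp : p.Prime := Nat.prime_of_mem_primeFactors hp
  have hep : 2 ≤ n.factorization p := by
    have h1 : 0 < n.factorization p := hpp.factorization_pos_of_dvd hn (Nat.dvd_of_mem_primeFactors hp)
    rcases hev with ⟨r, hr⟩; omega
  rw [← Finset.card_filter_add_card_filter_not (s := tset N n) (fun t ↦ p ∣ t)]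
  suffices h : ((tset N n).filter fun t ↦ ¬ p ∣ t).card = ((tset N n).filter fun t ↦ p ∣ t).card by
    rw [← h]; exact ⟨_, rfl⟩
  refine Finset.card_bij (fun t _ ↦ t * p ^ 2) (fun t ht ↦ ?_) (fun t₁ _ t₂ _ h ↦ ?_) (fun s hs ↦ ?_)
  · -- maps into `{p ∣ t}`
    rw [Finset.mem_filter] at ht ⊢
    obtain ⟨ht, hpt⟩ := ht
    obtain ⟨ht0, h⟩ := (mem_tset_iff hN hn).mp ht
    have hv0 : t.factorization p = 0 := Nat.factorization_eq_zero_of_not_dvd hpt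
    refine ⟨(mem_tset_iff hN hn).mpr ⟨mul_ne_zero ht0 (pow_ne_zero 2 hpp.ne_zero), fun q ↦ ?_⟩,
      Dvd.dvd.mul_left (dvd_pow_self p two_ne_zero) t⟩
    obtain ⟨h1, h2, h3, h4⟩ := h q
    rw [factorization_mul_sq ht0 hpp]
    by_cases hpq : p = q
    · subst hpq
      rw [if_pos rfl, hv0, zero_add, hNp]
      refine ⟨le_rfl, fun _ ↦ by decide, hep, ?_⟩
      exact (Nat.even_sub hep).mpr ⟨fun _ ↦ even_two, fun _ ↦ hev⟩
    · rw [if_neg hpq, add_zero]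
      exact ⟨h1, h2, h3, h4⟩
  · -- injective
    exact Nat.eq_of_mul_eq_mul_right (pow_pos hpp.pos 2) h
  · -- surjective
    rw [Finset.mem_filter] at hs
    obtain ⟨hs, hps⟩ := hs
    obtain ⟨hs0, h⟩ := (mem_tset_iff hN hn).mp hs
    obtain ⟨h1, h2, h3, h4⟩ := h p
    have hv2 : s.factorization p = 2 := by
      have hpos : 0 < s.factorization p := hpp.factorization_pos_of_dvd hs0 hps
      have hne1 : s.factorization p ≠ 1 := h2 (by rw [hNp])
      rw [hNp] at h1
      omega
    have hdvd : p ^ 2 ∣ s := (hpp.pow_dvd_iff_le_factorization hs0).mpr hv2.ge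
    obtain ⟨t, rfl⟩ := hdvd
    have ht0 : t ≠ 0 := by rintro rfl; exact hs0 (mul_zero _)
    have hvt : ∀ q, t.factorization q = (p ^ 2 * t).factorization q - if p = q then 2 else 0 := fun q ↦ by
      rw [mul_comm, factorization_mul_sq ht0 hpp, Nat.add_sub_cancel]
    refine ⟨t, ?_, by rw [mul_comm]⟩
    rw [Finset.mem_filter]
    have hvt0 : t.factorization p = 0 := by rw [hvt p, if_pos rfl, hv2]
    refine ⟨(mem_tset_iff hN hn).mpr ⟨ht0, fun q ↦ ?_⟩, fun hpt ↦ ?_⟩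
    · obtain ⟨g1, g2, g3, g4⟩ := h q
      by_cases hpq : p = q
      · subst hpq
        rw [hvt0]
        exact ⟨Nat.zero_le _, fun _ ↦ by decide, Nat.zero_le _, by rw [Nat.sub_zero]; exact hev⟩
      · rw [hvt q, if_neg hpq, Nat.sub_zero]
        exact ⟨g1, g2, g3, g4⟩
    · exact absurd hvt0 (hpp.factorization_pos_of_dvd ht0 hpt).ne'

/-- The canonical element `t₀ = ∏_{p ∥ N, v_p(n) odd} p`. [folklore] -/
def tzero (N n : ℕ) : ℕ :=
  ∏ p ∈ n.primeFactors.filter (fun p ↦ N.factorization p = 1 ∧ Odd (n.factorization p)), p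

/-- Exponents of `t₀`. [folklore] -/
theorem factorization_tzero (N n q : ℕ) :
    (tzero N n).factorization q =
      if q ∈ n.primeFactors.filter (fun p ↦ N.factorization p = 1 ∧ Odd (n.factorization p)) then 1 else 0 := by
  classical
  rw [tzero, Nat.factorization_prod fun x hx ↦ (Nat.prime_of_mem_primeFactors (Finset.mem_filter.mp hx).1).ne_zero,
    Finsupp.finsetSum_apply]
  rw [Finset.sum_congr rfl fun x hx ↦ by
    rw [(Nat.prime_of_mem_primeFactors (Finset.mem_filter.mp hx).1).factorization, Finsupp.single_apply]]
  exact Finset.sum_ite_eq' _ _ _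

/-- `t₀ ≠ 0`. [folklore] -/
theorem tzero_ne_zero (N n : ℕ) : tzero N n ≠ 0 :=
  Finset.prod_ne_zero_iff.mpr fun _ hx ↦ (Nat.prime_of_mem_primeFactors (Finset.mem_filter.mp hx).1).ne_zero

/-- Under the level pattern, `T_n = {t₀}`. [folklore] -/
theorem tset_eq_singleton {N n : ℕ} (hN : N ≠ 0) (hle2 : ∀ p ∈ N.primeFactors, N.factorization p ≤ 2)
    (hL : LevelPattern N n) : tset N n = {tzero N n} := by
  classical
  obtain ⟨hn, hLP⟩ := hL
  set S := n.primeFactors.filter (fun p ↦ N.factorization p = 1 ∧ Odd (n.factorization p)) with hS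
  have hmemS : ∀ q, q ∈ S ↔ q ∈ n.primeFactors ∧ N.factorization q = 1 ∧ Odd (n.factorization q) := fun q ↦ by
    rw [hS, Finset.mem_filter]
  have hf2 : ∀ q, N.factorization q ≤ 2 := fun q ↦ by
    by_cases hq : q ∈ N.primeFactors
    · exact hle2 q hq
    · rw [Finsupp.notMem_support_iff.mp (by rwa [Nat.support_factorization])]; exact Nat.zero_le _
  -- exponent facts about `n` off `S`
  have heven : ∀ q, q ∉ S → Even (n.factorization q) := fun q hq ↦ by
    by_cases hqn : q ∈ n.primeFactors
    · rcases hLP q hqn with ⟨-, h⟩ | h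
      · exact h
      · exact Nat.not_odd_iff_even.mp fun hodd ↦ hq ((hmemS q).mpr ⟨hqn, h, hodd⟩)
    · rw [Finsupp.notMem_support_iff.mp (by rwa [Nat.support_factorization])]; exact Even.zero
  refine Finset.eq_singleton_iff_unique_mem.mpr ⟨?_, fun t ht ↦ ?_⟩
  · -- `t₀ ∈ T_n`
    refine (mem_tset_iff hN hn).mpr ⟨tzero_ne_zero N n, fun q ↦ ?_⟩
    rw [factorization_tzero, ← hS]
    by_cases hq : q ∈ S
    · obtain ⟨-, hN1, hodd⟩ := (hmemS q).mp hq
      rw [if_pos hq, hN1]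
      exact ⟨le_rfl, fun h ↦ absurd h (by decide), hodd.pos, Nat.Odd.sub_odd hodd odd_one⟩
    · rw [if_neg hq, Nat.sub_zero]
      exact ⟨Nat.zero_le _, fun _ ↦ zero_ne_one, Nat.zero_le _, heven q hq⟩
  · -- uniqueness
    obtain ⟨ht0, h⟩ := (mem_tset_iff hN hn).mp ht
    refine Nat.eq_of_factorization_eq ht0 (tzero_ne_zero N n) fun q ↦ ?_
    rw [factorization_tzero, ← hS]
    obtain ⟨h1, h2, h3, h4⟩ := h q
    have hpar : Even (n.factorization q) ↔ Even (t.factorization q) := (Nat.even_sub h3).mp h4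
    by_cases hq : q ∈ S
    · obtain ⟨-, hN1, hodd⟩ := (hmemS q).mp hq
      rw [if_pos hq]
      rw [hN1] at h1
      rcases Nat.even_or_odd (t.factorization q) with hv | hv
      · exact absurd (hpar.mpr hv) (Nat.not_even_iff_odd.mpr hodd)
      · obtain ⟨r, hr⟩ := hv; omega
    · rw [if_neg hq]
      have hev := hpar.mp (heven q hq)
      -- `v_q(t) ∈ {0, 1, 2}` and even, and `≠ 2` unless `N.factorization q = 2`, where `q ∤ n`
      rcases Nat.even_or_odd (t.factorization q) with hv | hv
      · obtain ⟨r, hr⟩ := hv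
        have hle := (h1.trans (hf2 q))
        by_contra hne
        have hv2 : t.factorization q = 2 := by omega
        have hN2 : N.factorization q = 2 := le_antisymm (hf2 q) (hv2 ▸ h1)
        -- then `q ∣ n` (as `v_q t = 2 ≤ v_q n`) and the level pattern excludes `v_q N = 2`
        have hqn : q ∈ n.primeFactors := by
          rw [← Nat.support_factorization, Finsupp.mem_support_iff]; omega
        rcases hLP q hqn with ⟨h0, -⟩ | h1'
        · rw [hN2] at h0; exact absurd h0 (by decide)
        · rw [hN2] at h1'; exact absurd h1' (by decide)
      · exact absurd hv (Nat.not_odd_iff_even.mpr hev)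

/-! ## §4 Parity of `coeff_n θ_T` = the level pattern -/

/-- **Core**: for `N ≠ 0` with all exponents `≤ 2`, `coeff_n θ_T` is odd iff `LevelPattern N n`.
[cite: Stevens1982, §2.4 (PDF pp. 35–37)] -/
theorem odd_coeff_thetaPattern_iff {N : ℕ} (hN : N ≠ 0) (hle2 : ∀ p ∈ N.primeFactors, N.factorization p ≤ 2) (n : ℕ) :
    Odd (coeff n (thetaPattern N)) ↔ LevelPattern N n := by
  classical
  rcases eq_or_ne n 0 with rfl | hn
  · rw [coeff_zero_thetaPattern]
    exact ⟨fun h ↦ by simp at h, fun h ↦ absurd rfl h.1⟩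
  rw [coeff_thetaPattern hn]
  constructor
  · intro hodd
    by_contra hL
    have hL' : ∃ p ∈ n.primeFactors, ¬ ((N.factorization p = 0 ∧ Even (n.factorization p)) ∨ N.factorization p = 1) := by
      by_contra hall
      push Not at hall
      exact hL ⟨hn, hall⟩
    obtain ⟨p, hp, hbad⟩ := hL'
    have hf2 : N.factorization p ≤ 2 := by
      by_cases hq : p ∈ N.primeFactors
      · exact hle2 p hq
      · rw [Finsupp.notMem_support_iff.mp (by rwa [Nat.support_factorization])]; exact Nat.zero_le _
    have hne1 : N.factorization p ≠ 1 := fun h1 ↦ hbad (Or.inr h1)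
    have hcard_even : Even ((tset N n).card : ℤ) := by
      rcases Nat.even_or_odd (n.factorization p) with hev | hod
      · have hN2 : N.factorization p = 2 := by
          have hne0 : N.factorization p ≠ 0 := fun h0 ↦ hbad (Or.inl ⟨h0, hev⟩)
          omega
        exact (even_card_tset_of_sq hN hn hp hN2 hev).natCast
      · rcases (show N.factorization p = 0 ∨ N.factorization p = 2 by omega) with h0 | h2
        · rw [tset_eq_empty_of_good hN hn h0 hod, Finset.card_empty, Nat.cast_zero]; exact Even.zero
        · rw [tset_eq_empty_of_sq hN hn h2 hod, Finset.card_empty, Nat.cast_zero]; exact Even.zero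
    exact (Int.not_even_iff_odd.mpr hodd) hcard_even
  · intro hL
    rw [tset_eq_singleton hN hle2 hL, Finset.card_singleton, Nat.cast_one]
    exact odd_one

/-- The odd part `n / 2^{v₂ n}` carries the level pattern at odd level. [folklore] -/
theorem levelPattern_iff_two_split {N : ℕ} (hN2 : N.factorization 2 = 0) (n : ℕ) :
    LevelPattern N n ↔ Even (n.factorization 2) ∧ LevelPattern N (n / 2 ^ n.factorization 2) := by
  classical
  have hfac : ∀ q, (n / 2 ^ n.factorization 2).factorization q = if q = 2 then 0 else n.factorization q := fun q ↦ by
    rw [Nat.factorization_ordCompl n 2, Finsupp.erase_apply]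
  have hpf : (n / 2 ^ n.factorization 2).primeFactors = n.primeFactors.erase 2 := by
    rw [← Nat.support_factorization, ← Nat.support_factorization, Nat.factorization_ordCompl n 2, Finsupp.support_erase]
  unfold LevelPattern
  rw [hpf]
  constructor
  · rintro ⟨hn, h⟩
    refine ⟨?_, (Nat.ordCompl_pos 2 hn).ne', fun q hq ↦ ?_⟩
    · by_cases h2 : 2 ∈ n.primeFactors
      · rcases h 2 h2 with ⟨-, hev⟩ | h1
        · exact hev
        · rw [hN2] at h1; exact absurd h1 zero_ne_one
      · rw [Finsupp.notMem_support_iff.mp (by rwa [Nat.support_factorization])]; exact Even.zero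
    · obtain ⟨hq2, hqn⟩ := Finset.mem_erase.mp hq
      rw [hfac q, if_neg hq2]
      exact h q hqn
  · rintro ⟨hev, hn', h⟩
    have hn : n ≠ 0 := by rintro rfl; exact hn' (Nat.zero_div _)
    refine ⟨hn, fun q hqn ↦ ?_⟩
    by_cases hq2 : q = 2
    · subst hq2; exact Or.inl ⟨hN2, hev⟩
    · have := h q (Finset.mem_erase.mpr ⟨hq2, hqn⟩)
      rwa [hfac q, if_neg hq2] at this

/-! ## §5 KΘp -/

/-- **KΘp `stub_thetaPatternParity`**: for odd `N` with all exponents `≤ 2`, `coeff_n θ_T` is odd iff `v₂(n)` is even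
and the odd part of `n` has the level pattern.  Literally the v7 stub (with the v7 design's `thetaSq`,
`thetaPattern`, `LevelPattern`). [cite: Stevens1982, §2.4 (PDF pp. 35–37)] -/
theorem thetaPatternParity :
    ∀ N : ℕ, Odd N → (∀ p ∈ N.primeFactors, N.factorization p ≤ 2) →
      ∀ n : ℕ, Odd (coeff n (thetaPattern N)) ↔
        (Even (n.factorization 2) ∧ LevelPattern N (n / 2 ^ n.factorization 2)) := by
  intro N hodd hle2 n
  have hN : N ≠ 0 := fun h ↦ by simp [h] at hodd
  have hN2 : N.factorization 2 = 0 :=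
    Nat.factorization_eq_zero_of_not_dvd fun h ↦ (Nat.not_even_iff_odd.mpr hodd) (even_iff_two_dvd.mpr h)
  rw [odd_coeff_thetaPattern_iff hN hle2, levelPattern_iff_two_split hN2]

end Summit.BirchSwinnertonDyer.BirchSwinnertonDyer.Theorems.DepletionAtTwo.KEta.ThetaPattern
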